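import Literature.Topology.PlanarFoliations.Kneser
import Literature.Topology.FourManifolds.TautFoliationsFoliatedMaps
import HarnessLib

/-!
# Planar foliations induced by a map with finitely many punctures

Topic: Topology / PlanarFoliations, sequel to `OmegaLimit.lean`, `Reverse.lean`, `Kneser.lean`.
The abstract setting of a **foliation with isolated singularities of a plane region induced by
a map into a foliated manifold** (Camacho–Lins Neto, *Geometric Theory of Foliations*, Ch. VI
§3–4: the singular foliation `g*(𝔉)` of the disc; here `C⁰`): an open region `Ω ⊆ ℂ`, a finite
set `P ⊆ Ω` of **punctures**, a bi-oriented foliation `F` of `X ≅ Ω ∖ P` (open embedding `ι`),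
and a map `g : ℂ → M`, continuous on `Ω`, which is a foliated map `(X, F) → (M, T)` off the
punctures and which, near each puncture `v`, takes values in one flow box `box v` of `T`; the
**level** `h_{box v} ∘ g` is then a continuous function near `v`, constant along the leaves of
`F` (`level_eq_of_isPreconnected`), and the one requirement on the singularity is **finiteness**:
the points near `v` at the level of `v` lie on finitely many leaves (`PunctureData.finite_level`)
— centres (no such point), saddles and multi-saddles (finitely many prongs).

Main results:

* `exists_image_fwd_subset` (**proved**): a leaf in a compact set eventually enters every
  neighbourhood of its ω-limit set (Cantor); `isPreconnected_fwd`.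
* `exists_mem_levelLeaves_of_omegaSet_subset` (**proved**): **a leaf end converging to a
  puncture `v` (`ω(L) ⊆ {v}`) runs on one of the finitely many level leaves of `v`** — its level
  is eventually constant and tends to the level of `v`; likewise for α-limits
  (`exists_mem_levelLeaves_of_alphaSet_subset`); in particular there are only finitely many
  separatrices.
* `eventually_mem_leaf_of_level_eq` (**proved**): near a point of the ball, equal level means
  same leaf (the level is a homeomorphism germ of a flow-box height, `IsFoliatedMap.exists_compat`).
* `exists_forall_isCompact_leaf` (**proved**): **near a centre** (no point of the ball at the
  level of the puncture) **all leaves are compact**, of constant level, inside the half-ball.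

All statements are [folklore] (Camacho–Lins Neto, Ch. VI §4).
-/

noncomputable section

open Set Filter Function Bornology Metric
open _root_.Topology
open Literature.Topology.FourManifolds Literature.Topology.FourManifolds.Foliation
  Literature.Topology.FourManifolds.OneManifold Literature.Topology.PlaneTopology

namespace Literature.Topology.PlanarFoliations

variable {X : Type*} [TopologicalSpace X] {F : Foliation ℝ X} {x : X}
variable {hbi : IsBiOriented F} {ι : X → ℂ}
variable {B : Type*} [TopologicalSpace B] {M : Type*} [TopologicalSpace M] {T : Foliation B M} {g : ℂ → M}

variable (F ι T g) in
/-- **Puncture data**: a plane region `Ω`, finitely many punctures `P`, `X ≅ Ω ∖ P` via `ι`, a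
map `g` continuous on `Ω`, foliated off `P`, with one flow box of `T` around the image of each
puncture and finitely many level leaves at each puncture. [cite: CamachoLinsNeto1985, Ch. VI §3] -/
structure PunctureData where
  /-- The plane region. -/
  Ω : Set ℂ
  /-- The region is open. -/
  isOpen_Ω : IsOpen Ω
  /-- The punctures. -/
  P : Set ℂ
  /-- There are finitely many punctures. -/
  P_finite : P.Finite
  /-- The punctures lie in the region. -/
  P_subset : P ⊆ Ω
  /-- The domain of the foliation is the punctured region. -/
  range_eq : range ι = Ω \ P
  /-- The map is continuous on the region. -/
  continuousOn : ContinuousOn g Ω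
  /-- The map is foliated off the punctures. -/
  foliated : IsFoliatedMap F T (g ∘ ι)
  /-- The flow box at (the image of) each puncture. -/
  box : ℂ → OpenPartialHomeomorph M (B × ℝ)
  /-- The flow boxes belong to the atlas. -/
  box_mem : ∀ v ∈ P, box v ∈ T.atlas
  /-- The radius of the ball around each puncture. -/
  rad : ℂ → ℝ
  /-- The radii are positive. -/
  rad_pos : ∀ v ∈ P, 0 < rad v
  /-- The balls lie in the region. -/
  ball_subset : ∀ v ∈ P, ball v (rad v) ⊆ Ω
  /-- The balls contain no other puncture. -/
  eq_of_mem_ball : ∀ v ∈ P, ∀ v' ∈ P, v' ∈ ball v (rad v) → v' = v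
  /-- The map sends each ball into the flow box. -/
  mapsTo_ball : ∀ v ∈ P, MapsTo g (ball v (rad v)) (box v).source
  /-- **Finiteness**: the points of the ball at the level of the puncture lie on finitely many
  leaves. -/
  finite_level : ∀ v ∈ P, ∃ S : Set X, S.Finite ∧ ∀ y, ι y ∈ ball v (rad v) →
    (box v (g (ι y))).2 = (box v (g v)).2 → ∃ s ∈ S, y ∈ F.leaf s

namespace PunctureData

variable (D : PunctureData F ι T g)

/-- **The level function** at the puncture `v`: the transverse coordinate of `g` in the flow box
of `v`. [folklore] -/
def level (v z : ℂ) : ℝ := (D.box v (g z)).2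

/-- The chosen finite set of base points of the **level leaves** at `v`. [folklore] -/
def levelLeaves (v : ℂ) : Set X := by
  classical
  exact if hv : v ∈ D.P then (D.finite_level v hv).choose else ∅

/-- The level leaves are finitely many. [folklore] -/
theorem finite_levelLeaves (v : ℂ) : (D.levelLeaves v).Finite := by
  unfold levelLeaves
  split_ifs with hv
  · exact (D.finite_level v hv).choose_spec.1
  · exact finite_empty

/-- The points of the ball at the level of the puncture lie on the level leaves. [folklore] -/
theorem exists_mem_levelLeaves {v : ℂ} (hv : v ∈ D.P) {y : X} (hy : ι y ∈ ball v (D.rad v))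
    (hl : D.level v (ι y) = D.level v v) : ∃ s ∈ D.levelLeaves v, y ∈ F.leaf s := by
  unfold levelLeaves
  rw [dif_pos hv]
  exact (D.finite_level v hv).choose_spec.2 y hy hl

/-- Points of the domain are in the region and are not punctures. [folklore] -/
theorem image_mem (y : X) : ι y ∈ D.Ω ∧ ι y ∉ D.P := by
  have h : ι y ∈ range ι := mem_range_self y
  rw [D.range_eq] at h
  exact h

/-- A point of the region which is not a puncture is in the domain. [folklore] -/
theorem mem_range {z : ℂ} (hz : z ∈ D.Ω) (hzP : z ∉ D.P) : z ∈ range ι := by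
  rw [D.range_eq]; exact ⟨hz, hzP⟩

/-- **The level function is continuous on the ball.** [folklore] -/
theorem continuousOn_level {v : ℂ} (hv : v ∈ D.P) : ContinuousOn (D.level v) (ball v (D.rad v)) := by
  intro z hz
  have hg : ContinuousAt g z := (D.continuousOn z (D.ball_subset v hv hz)).continuousAt
    (D.isOpen_Ω.mem_nhds (D.ball_subset v hv hz))
  exact (continuous_snd.continuousAt.comp (((D.box v).continuousAt (D.mapsTo_ball v hv hz)).comp hg)).continuousWithinAt

/-- The level function is continuous at the points of the ball. [folklore] -/
theorem continuousAt_level {v : ℂ} (hv : v ∈ D.P) {z : ℂ} (hz : z ∈ ball v (D.rad v)) : ContinuousAt (D.level v) z :=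
  (D.continuousOn_level hv).continuousAt (isOpen_ball.mem_nhds hz)

/-! ## Levels are constant along leaves -/

/-- **The level is locally constant along leafwise maps inside the ball**: a map `γ : A → X`
continuous into the leaf space, with image in the ball of `v`, has locally constant level.
[folklore] -/
theorem isLocallyConstant_level {v : ℂ} (hv : v ∈ D.P) {A : Type*} [TopologicalSpace A] {γ : A → X}
    (hγ : Continuous (toLeafSpace ∘ γ : A → F.LeafSpace)) (hA : ∀ a, ι (γ a) ∈ ball v (D.rad v)) :
    IsLocallyConstant fun a ↦ D.level v (ι (γ a)) := by
  refine (IsLocallyConstant.iff_eventually_eq _).2 fun a ↦ ?_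
  have hT : Continuous (toLeafSpace ∘ ((g ∘ ι) ∘ γ) : A → T.LeafSpace) := D.foliated.continuous_leafMap.comp hγ
  have h := T.eventually_height_eq_of_continuousAt hT.continuousAt (D.box_mem v hv) (D.mapsTo_ball v hv (hA a))
  filter_upwards [h] with b hb
  exact hb

/-- **The level is constant along leafwise maps from preconnected spaces inside the ball.**
[folklore] -/
theorem level_eq_of_preconnectedSpace {v : ℂ} (hv : v ∈ D.P) {A : Type*} [TopologicalSpace A] [PreconnectedSpace A]
    {γ : A → X} (hγ : Continuous (toLeafSpace ∘ γ : A → F.LeafSpace)) (hA : ∀ a, ι (γ a) ∈ ball v (D.rad v)) (a b : A) :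
    D.level v (ι (γ a)) = D.level v (ι (γ b)) :=
  (D.isLocallyConstant_level hv hγ hA).apply_eq_of_preconnectedSpace a b

/-- **The level is constant on preconnected subsets of a leaf inside the ball.** [folklore] -/
theorem level_eq_of_isPreconnected {v : ℂ} (hv : v ∈ D.P) {A : Set (F.Leaf x)} (hA : IsPreconnected A)
    (hball : ∀ q ∈ A, ι (Leaf.pt q) ∈ ball v (D.rad v)) {p q : F.Leaf x} (hp : p ∈ A) (hq : q ∈ A) :
    D.level v (ι (Leaf.pt p)) = D.level v (ι (Leaf.pt q)) := by
  haveI : PreconnectedSpace A := isPreconnected_iff_preconnectedSpace.1 hA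
  have hγ : Continuous (toLeafSpace ∘ (fun a : A ↦ Leaf.pt (a : F.Leaf x)) : A → F.LeafSpace) :=
    continuous_subtype_val.comp continuous_subtype_val
  exact D.level_eq_of_preconnectedSpace hv hγ (fun a ↦ hball a a.2) ⟨p, hp⟩ ⟨q, hq⟩

/-! ## Forward half-leaves: preconnected, eventually near the ω-limit set -/

variable [T2Space X] [SecondCountableTopology X]

section Fwd

variable [NoncompactSpace (F.Leaf x)]

/-- Forward half-leaves are preconnected (the closure of the open forward ray contains its
origin). [folklore] -/
theorem isPreconnected_fwd (p : F.Leaf x) : IsPreconnected (fwd hbi p) := by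
  have hray : {s | leafLT hbi p s} ⊆ fwd hbi p := fun s hs ↦ mem_fwd_of_leafLT hs
  have hcl : fwd hbi p ⊆ closure {s | leafLT hbi p s} := by
    intro s hs
    rcases not_leafLT_iff.1 hs with h | rfl
    · exact subset_closure h
    · exact (frequently_leafLT_right (hbi := hbi) p).mem_closure
  exact (isPreconnected_setOf_leafLT_right p).subset_closure hray hcl

/-- Backward half-leaves are preconnected. [folklore] -/
theorem isPreconnected_bwd (p : F.Leaf x) : IsPreconnected (bwd hbi p) := by
  have hray : {s | leafLT hbi s p} ⊆ bwd hbi p := fun s hs ↦ leafLT_asymm hs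
  have hcl : bwd hbi p ⊆ closure {s | leafLT hbi s p} := by
    intro s hs
    rcases not_leafLT_iff.1 hs with h | rfl
    · exact subset_closure h
    · exact (frequently_leafLT_left (hbi := hbi) s).mem_closure
  exact (isPreconnected_setOf_leafLT_left p).subset_closure hray hcl

/-- **A leaf in a compact set eventually enters every neighbourhood of its ω-limit set**
(Cantor's intersection theorem). [folklore] -/
theorem exists_image_fwd_subset {C : Set ℂ} (hC : IsCompact C) (hmem : ∀ q : F.Leaf x, ι (Leaf.pt q) ∈ C)
    {U : Set ℂ} (hU : IsOpen U) (hωU : omegaSet hbi ι x ⊆ U) :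
    ∃ p : F.Leaf x, (fun q : F.Leaf x ↦ ι (Leaf.pt q)) '' fwd hbi p ⊆ U := by
  haveI : Nonempty (F.Leaf x) := ⟨Leaf.base F x⟩
  set t : F.Leaf x → Set ℂ := fun p ↦ closure ((fun q : F.Leaf x ↦ ι (Leaf.pt q)) '' fwd hbi p) with ht
  have hdir : Directed (· ⊇ ·) t := fun p p' ↦ by
    rcases leafLT_trichotomy (hbi := hbi) p p' with hlt | rfl | hlt
    · exact ⟨p', closure_mono (image_mono (fwd_mono (leafLT_asymm hlt))), subset_rfl⟩
    · exact ⟨p, subset_rfl, subset_rfl⟩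
    · exact ⟨p, subset_rfl, closure_mono (image_mono (fwd_mono (leafLT_asymm hlt)))⟩
  have hempty : (Uᶜ ∩ C) ∩ ⋂ p, t p = ∅ := by
    apply eq_empty_of_forall_notMem
    rintro z ⟨⟨hzU, -⟩, hz⟩
    exact hzU (hωU hz)
  obtain ⟨p, hp⟩ := (hC.inter_left hU.isClosed_compl).elim_directed_family_closed t (fun _ ↦ isClosed_closure) hempty hdir
  refine ⟨p, fun z hz ↦ ?_⟩
  by_contra hzU
  have hzC : z ∈ C := by obtain ⟨q, -, rfl⟩ := hz; exact hmem q
  have : z ∈ (Uᶜ ∩ C) ∩ t p := ⟨⟨hzU, hzC⟩, subset_closure hz⟩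
  rw [hp] at this
  exact this

/-- **A leaf in a compact set eventually enters every neighbourhood of its α-limit set.**
[folklore] -/
theorem exists_image_bwd_subset {C : Set ℂ} (hC : IsCompact C) (hmem : ∀ q : F.Leaf x, ι (Leaf.pt q) ∈ C)
    {U : Set ℂ} (hU : IsOpen U) (hαU : alphaSet hbi ι x ⊆ U) :
    ∃ p : F.Leaf x, (fun q : F.Leaf x ↦ ι (Leaf.pt q)) '' bwd hbi p ⊆ U := by
  rw [alphaSet_eq_omegaSet_flip] at hαU
  obtain ⟨p', hp'⟩ := exists_image_fwd_subset (hbi := isBiOriented_flip hbi) hC (fun q ↦ hmem ((Leaf.toFlip x).symm q)) hU hαU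
  refine ⟨(Leaf.toFlip x).symm p', ?_⟩
  rw [← (Leaf.toFlip x).apply_symm_apply p', fwd_flip_eq_image, image_image] at hp'
  exact hp'

end Fwd

/-! ## Leaf ends at punctures run on the level leaves -/

section Ends

variable [NoncompactSpace (F.Leaf x)]

/-- **A forward leaf end converging to the puncture `v` runs on a level leaf of `v`**: if the
leaf lies in a compact set and `ω(L) ⊆ {v}`, then `L` is the leaf of one of the finitely many
`levelLeaves v` — the forward half-leaf eventually stays in the ball, its level is constant there
and tends to the level of `v` along points approaching `v`. [folklore] -/
theorem exists_mem_levelLeaves_of_omegaSet_subset {v : ℂ} (hv : v ∈ D.P) {C : Set ℂ} (hC : IsCompact C)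
    (hmem : ∀ q : F.Leaf x, ι (Leaf.pt q) ∈ C) (hω : omegaSet hbi ι x ⊆ {v}) :
    ∃ s ∈ D.levelLeaves v, x ∈ F.leaf s := by
  -- the ω-limit set is nonempty, hence `{v}`
  obtain ⟨z, hz⟩ := omegaSet_nonempty_of_forall_mem (hbi := hbi) hC hmem
  have hzv : z = v := hω hz
  subst hzv
  -- eventually in the ball
  obtain ⟨p, hp⟩ := exists_image_fwd_subset hC hmem isOpen_ball (fun w hw ↦ by rw [hω hw]; exact mem_ball_self (D.rad_pos _ hv))
  have hball : ∀ q ∈ fwd hbi p, ι (Leaf.pt q) ∈ ball z (D.rad z) := fun q hq ↦ hp ⟨q, hq, rfl⟩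
  -- constant level `c` on the forward half-leaf
  have hconst : ∀ q ∈ fwd hbi p, D.level z (ι (Leaf.pt q)) = D.level z (ι (Leaf.pt p)) := fun q hq ↦
    D.level_eq_of_isPreconnected hv (isPreconnected_fwd p) hball hq (mem_fwd_self p)
  -- the level of `v` is a limit of levels of points of the forward half-leaf
  have hlev : D.level z (ι (Leaf.pt p)) = D.level z z := by
    by_contra hne
    have hcl : z ∈ closure ((fun q : F.Leaf x ↦ ι (Leaf.pt q)) '' fwd hbi p) := (mem_omegaSet_iff.1 hz) p
    have hcont := D.continuousAt_level hv (mem_ball_self (D.rad_pos _ hv))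
    have hopen : ({w | D.level z w ≠ D.level z (ι (Leaf.pt p))} ∩ ball z (D.rad z)) ∈ 𝓝 z :=
      inter_mem (hcont.preimage_mem_nhds (isOpen_ne.mem_nhds (Ne.symm hne)))
        (isOpen_ball.mem_nhds (mem_ball_self (D.rad_pos _ hv)))
    obtain ⟨w, hw, ⟨q, hq, rfl⟩⟩ := mem_closure_iff_nhds.1 hcl _ hopen
    exact hw.1 (hconst q hq)
  obtain ⟨s₀, hs₀, hps⟩ := D.exists_mem_levelLeaves hv (hball p (mem_fwd_self p)) hlev
  exact ⟨s₀, hs₀, by rw [← leaf_eq_of_mem hps]; exact mem_leaf_comm.1 p.2⟩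

/-- **A backward leaf end converging to the puncture `v` runs on a level leaf of `v`.**
[folklore] -/
theorem exists_mem_levelLeaves_of_alphaSet_subset {v : ℂ} (hv : v ∈ D.P) {C : Set ℂ} (hC : IsCompact C)
    (hmem : ∀ q : F.Leaf x, ι (Leaf.pt q) ∈ C) (hα : alphaSet hbi ι x ⊆ {v}) :
    ∃ s ∈ D.levelLeaves v, x ∈ F.leaf s := by
  obtain ⟨z, hz⟩ := alphaSet_nonempty_of_forall_mem (hbi := hbi) hC hmem
  have hzv : z = v := hα hz
  subst hzv
  obtain ⟨p, hp⟩ := exists_image_bwd_subset hC hmem isOpen_ball (fun w hw ↦ by rw [hα hw]; exact mem_ball_self (D.rad_pos _ hv))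
  have hball : ∀ q ∈ bwd hbi p, ι (Leaf.pt q) ∈ ball z (D.rad z) := fun q hq ↦ hp ⟨q, hq, rfl⟩
  have hconst : ∀ q ∈ bwd hbi p, D.level z (ι (Leaf.pt q)) = D.level z (ι (Leaf.pt p)) := fun q hq ↦
    D.level_eq_of_isPreconnected hv (isPreconnected_bwd p) hball hq (mem_bwd_self p)
  have hlev : D.level z (ι (Leaf.pt p)) = D.level z z := by
    by_contra hne
    have hcl : z ∈ closure ((fun q : F.Leaf x ↦ ι (Leaf.pt q)) '' bwd hbi p) := (mem_alphaSet_iff.1 hz) p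
    have hcont := D.continuousAt_level hv (mem_ball_self (D.rad_pos _ hv))
    have hopen : ({w | D.level z w ≠ D.level z (ι (Leaf.pt p))} ∩ ball z (D.rad z)) ∈ 𝓝 z :=
      inter_mem (hcont.preimage_mem_nhds (isOpen_ne.mem_nhds (Ne.symm hne)))
        (isOpen_ball.mem_nhds (mem_ball_self (D.rad_pos _ hv)))
    obtain ⟨w, hw, ⟨q, hq, rfl⟩⟩ := mem_closure_iff_nhds.1 hcl _ hopen
    exact hw.1 (hconst q hq)
  obtain ⟨s₀, hs₀, hps⟩ := D.exists_mem_levelLeaves hv (hball p (mem_bwd_self p)) hlev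
  exact ⟨s₀, hs₀, by rw [← leaf_eq_of_mem hps]; exact mem_leaf_comm.1 p.2⟩

end Ends

/-! ## Same level near a point means same leaf -/

section SameLevel

omit [T2Space X] [SecondCountableTopology X] in
/-- **Near a point of the ball, points at the level of that point lie on its leaf**: the level
is a homeomorphism germ of the height of a flow box of `F` (`IsFoliatedMap.exists_compat`), in
particular injective near the height of the point. [folklore] -/
theorem eventually_mem_leaf_of_level_eq (hι : IsOpenEmbedding ι) {v : ℂ} (hv : v ∈ D.P) {y₀ : X}
    (hy₀ : ι y₀ ∈ ball v (D.rad v)) :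
    ∀ᶠ y in 𝓝 y₀, D.level v (ι y) = D.level v (ι y₀) → y ∈ F.leaf y₀ := by
  obtain ⟨c, hc, hyc⟩ := F.exists_mem_source y₀
  obtain ⟨φ, hφ, hcomp⟩ := D.foliated.exists_compat hc hyc (D.box_mem v hv) (D.mapsTo_ball v hv hy₀)
  obtain ⟨U, hU, hinj⟩ := hφ.eventually_injective
  have hlc : ContinuousAt (fun y ↦ D.level v (ι y)) y₀ := (D.continuousAt_level hv hy₀).comp hι.continuous.continuousAt
  have hUev : ∀ᶠ y in 𝓝 y₀, D.level v (ι y) ∈ U := hlc.preimage_mem_nhds hU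
  have hsrc : ∀ᶠ y in 𝓝 y₀, y ∈ c.source := c.open_source.mem_nhds hyc
  filter_upwards [hcomp, hUev, hsrc] with y hy hyU hys hlev
  have h₀ : height c y₀ = φ (D.level v (ι y₀)) := hcomp.self_of_nhds
  have h₁ : height c y = height c y₀ := by
    rw [hy, h₀]
    show φ (D.level v (ι y)) = φ (D.level v (ι y₀))
    rw [hlev]
  exact (F.samePlaque_of_mem_plaque hc ⟨hyc, rfl⟩ ⟨hys, h₁⟩).mem_leaf

end SameLevel

/-! ## Centres: nearby leaves are compact -/

section Centres

/-- **Near a centre all leaves are compact.** Let `v` be a puncture with no point of the ball at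
its level (a *centre*: a strict local extremum of the level). Then every leaf through a point
close enough to `v` is compact and its image lies in the ball of radius `rad v / 2` around `v`:
the leaf lies in the compact level set of its level inside the half-ball (the level is constant
along the leaf and the levels of the half-sphere stay away from the level of `v`), which is in
the domain; were the leaf open, an ω-limit point of it would be a point of the domain at the
same level, hence on the same leaf near it (`eventually_mem_leaf_of_level_eq`), and the leaf
would accumulate on itself (`not_mem_omegaSet_self`). [folklore] -/
theorem exists_forall_isCompact_leaf (hbi : IsBiOriented F) (hι : IsOpenEmbedding ι) {v : ℂ} (hv : v ∈ D.P)
    (hno : ∀ y, ι y ∈ ball v (D.rad v) → D.level v (ι y) ≠ D.level v v) :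
    ∃ r' > (0 : ℝ), ∀ y, ι y ∈ ball v r' →
      IsCompact (F.leaf y) ∧ ι '' F.leaf y ⊆ ball v (D.rad v / 2) ∧ ∀ y' ∈ F.leaf y, D.level v (ι y') = D.level v (ι y) := by
  set r := D.rad v with hr
  have hr₀ : 0 < r := D.rad_pos v hv
  -- points of the punctured ball are in the domain
  have hdom : ∀ {z}, z ∈ ball v r → z ≠ v → z ∈ range ι := fun {z} hz hzv ↦
    D.mem_range (D.ball_subset v hv hz) fun hzP ↦ hzv (D.eq_of_mem_ball v hv z hzP hz)
  -- the levels on the half-sphere avoid the level of `v`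
  set S := sphere v (r / 2) with hS
  have hSball : S ⊆ ball v r := sphere_subset_ball (by linarith)
  have hSc : IsCompact S := isCompact_sphere _ _
  have hlevS : ContinuousOn (D.level v) S := (D.continuousOn_level hv).mono hSball
  have hLS : IsCompact (D.level v '' S) := hSc.image_of_continuousOn hlevS
  have hvS : D.level v v ∉ D.level v '' S := by
    rintro ⟨z, hz, hzl⟩
    have hzv : z ≠ v := by intro h; rw [h, hS, mem_sphere, dist_self] at hz; linarith
    obtain ⟨y, rfl⟩ := hdom (hSball hz) hzv
    exact hno y (hSball hz) hzl
  obtain ⟨δ, hδ, hδS⟩ : ∃ δ > (0 : ℝ), ∀ w ∈ D.level v '' S, δ ≤ |w - D.level v v| := by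
    rcases (D.level v '' S).eq_empty_or_nonempty with h | hne
    · exact ⟨1, one_pos, fun w hw ↦ by rw [h] at hw; exact absurd hw (notMem_empty w)⟩
    · obtain ⟨w₀, hw₀, hmin⟩ := hLS.exists_isMinOn hne (continuous_id.sub continuous_const).abs.continuousOn
      refine ⟨|w₀ - D.level v v|, abs_pos.2 (sub_ne_zero.2 fun h ↦ hvS (h ▸ hw₀)), fun w hw ↦ hmin hw⟩
  -- the radius `r'`: levels within `δ` of the level of `v`
  have hcont := D.continuousAt_level hv (mem_ball_self hr₀)
  obtain ⟨r₁, hr₁, hr₁δ⟩ := Metric.mem_nhds_iff.1 (hcont.preimage_mem_nhds (Metric.ball_mem_nhds (D.level v v) hδ))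
  set r' := min r₁ (r / 2) with hr'
  have hr'₀ : 0 < r' := lt_min hr₁ (by linarith)
  refine ⟨r', hr'₀, fun y hy ↦ ?_⟩
  have hyr₁ : ι y ∈ ball v r₁ := ball_subset_ball (min_le_left _ _) hy
  have hyhalf : ι y ∈ ball v (r / 2) := ball_subset_ball (min_le_right _ _) hy
  have hyr : ι y ∈ ball v r := ball_subset_ball (by rw [hr']; linarith [min_le_right r₁ (r / 2)]) hy
  set c := D.level v (ι y) with hc
  have hcδ : |c - D.level v v| < δ := by
    have h := hr₁δ hyr₁
    rwa [mem_preimage, Metric.mem_ball, Real.dist_eq] at h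
  have hcS : ∀ z ∈ S, D.level v z ≠ c := fun z hz h ↦ by
    have := hδS _ ⟨z, hz, h⟩
    linarith
  -- the compact level set `Z` inside the half-ball, in the domain
  set Z : Set ℂ := closedBall v (r / 2) ∩ D.level v ⁻¹' {c} with hZ
  have hZclosed : IsClosed Z :=
    ((D.continuousOn_level hv).mono (closedBall_subset_ball (by linarith))).preimage_isClosed_of_isClosed
      isClosed_closedBall isClosed_singleton
  have hZc : IsCompact Z := (isCompact_closedBall v (r / 2)).of_isClosed_subset hZclosed inter_subset_left
  have hZball : Z ⊆ ball v (r / 2) := fun z hz ↦ by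
    rcases (mem_closedBall.1 hz.1).lt_or_eq with h | h
    · exact h
    · exact absurd hz.2 (hcS z h)
  have hZv : v ∉ Z := fun h ↦ hno y hyr (h.2 : D.level v v = c).symm
  have hZdom : Z ⊆ range ι := fun z hz ↦ hdom (ball_subset_ball (by linarith) (hZball hz)) fun h ↦ hZv (h ▸ hz)
  -- the whole leaf lies in `Z`
  have hleafZ : ∀ q : F.Leaf y, ι (Leaf.pt q) ∈ ball v (r / 2) ∧ D.level v (ι (Leaf.pt q)) = c := by
    set W : Set (F.Leaf y) := {q | ι (Leaf.pt q) ∈ ball v (r / 2) ∧ D.level v (ι (Leaf.pt q)) = c} with hW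
    have hιpt : Continuous fun q : F.Leaf y ↦ ι (Leaf.pt q) := hι.continuous.comp (Leaf.continuous_coe F y)
    have hWo : IsOpen W := by
      refine isOpen_iff_mem_nhds.2 fun q hq ↦ ?_
      have hT : ContinuousAt (toLeafSpace ∘ ((g ∘ ι) ∘ fun q : F.Leaf y ↦ Leaf.pt q) : F.Leaf y → T.LeafSpace) q :=
        (D.foliated.continuous_leafMap.comp continuous_subtype_val).continuousAt
      have hlev := T.eventually_height_eq_of_continuousAt hT (D.box_mem v hv)
        (D.mapsTo_ball v hv (ball_subset_ball (by linarith) hq.1))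
      have hball' : ∀ᶠ q' in 𝓝 q, ι (Leaf.pt q') ∈ ball v (r / 2) := hιpt.continuousAt.preimage_mem_nhds (isOpen_ball.mem_nhds hq.1)
      filter_upwards [hlev, hball'] with q' h₁ h₂
      exact ⟨h₂, h₁.trans hq.2⟩
    have hWc : IsClosed W := by
      have h : W = (fun q : F.Leaf y ↦ ι (Leaf.pt q)) ⁻¹' Z := by
        ext q
        constructor
        · exact fun hq ↦ ⟨ball_subset_closedBall hq.1, hq.2⟩
        · exact fun hq ↦ ⟨hZball hq, hq.2⟩
      rw [h]
      exact hZclosed.preimage hιpt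
    have hWuniv : W = univ := IsClopen.eq_univ ⟨hWc, hWo⟩ ⟨Leaf.base F y, hyhalf, rfl⟩
    intro q
    have hq : q ∈ W := by rw [hWuniv]; exact mem_univ q
    exact hq
  have himg : ι '' F.leaf y ⊆ Z := by
    rintro _ ⟨y', hy', rfl⟩
    have h := hleafZ ⟨toLeafSpace y', hy'⟩
    exact ⟨ball_subset_closedBall h.1, h.2⟩
  refine ⟨?_, fun z hz ↦ hZball (himg hz), fun y' hy' ↦ (hleafZ ⟨toLeafSpace y', hy'⟩).2⟩
  -- compactness: otherwise an ω-limit point in `Z` is on the same leaf nearby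
  by_contra hcy
  haveI := noncompactSpace_leaf_of_not_isCompact' hcy
  have hmem : ∀ q : F.Leaf y, ι (Leaf.pt q) ∈ Z := fun q ↦ ⟨ball_subset_closedBall (hleafZ q).1, (hleafZ q).2⟩
  obtain ⟨z₀, hz₀⟩ := omegaSet_nonempty_of_forall_mem (hbi := hbi) hZc hmem
  have hz₀Z : z₀ ∈ Z := omegaSet_subset_of_forall_mem hZc.isClosed hmem hz₀
  obtain ⟨y₀, rfl⟩ := hZdom hz₀Z
  have hy₀ball : ι y₀ ∈ ball v r := ball_subset_ball (by linarith) (hZball hz₀Z)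
  -- points of `L_y` near `y₀`: same level, hence on the leaf of `y₀`
  have hev := D.eventually_mem_leaf_of_level_eq hι hv hy₀ball
  obtain ⟨e, he, hy₀e⟩ := F.exists_mem_source y₀
  set u₀ := (e y₀).1
  set s₀ := (e y₀).2
  have hy₀eq : y₀ = e.symm (u₀, s₀) := by rw [show (u₀, s₀) = e y₀ from rfl, e.left_inv hy₀e]
  have hcv : ContinuousAt (fun t : ℝ ↦ e.symm (u₀, t)) s₀ :=
    (F.continuous_symm_of_mem he).continuousAt.comp (continuousAt_const.prodMk continuousAt_id)
  have hev' : ∀ᶠ t in 𝓝 s₀, D.level v (ι (e.symm (u₀, t))) = D.level v (ι y₀) → e.symm (u₀, t) ∈ F.leaf y₀ := by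
    have h := hcv.eventually (show ∀ᶠ y in 𝓝 (e.symm (u₀, s₀)), _ from hy₀eq ▸ hev)
    rw [← hy₀eq] at h
    exact h
  obtain ⟨ε, hε, hball⟩ := Metric.eventually_nhds_iff.1 hev'
  rw [hy₀eq] at hz₀
  obtain ⟨cr, hcr, hnear⟩ := exists_crossing_near₀ (hbi := hbi) he hι hz₀ hε
  have hlevcr : D.level v (ι (e.symm (u₀, ht e cr))) = D.level v (ι y₀) := by
    rw [← hcr.pt_eq, (hleafZ cr).2]
    exact hz₀Z.2.symm
  have hmemcr : Leaf.pt cr ∈ F.leaf y₀ := by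
    rw [hcr.pt_eq]
    exact hball (by rwa [Real.dist_eq]) hlevcr
  -- so `y₀ ∈ L_y` and `L_y` accumulates on itself
  have hcrL : Leaf.pt cr ∈ F.leaf y := cr.2
  have hy₀L : y₀ ∈ F.leaf y := by rw [← leaf_eq_of_mem hcrL, leaf_eq_of_mem hmemcr]; exact F.mem_leaf_self y₀
  rw [← hy₀eq] at hz₀
  exact not_mem_omegaSet_self hbi hι ⟨toLeafSpace y₀, hy₀L⟩ hz₀

end Centres

end PunctureData

end Literature.Topology.PlanarFoliations
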